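import Mathlib
import HarnessLib
import Summits.HubbardSuperconductivity.HubbardSuperconductivity.Theorems.KLProgrammeKLRegimeSplitGlueP4
import Summits.HubbardSuperconductivity.HubbardSuperconductivity.Theorems.KLProgrammeKLRegimeSplitGenericV5
import Summits.HubbardSuperconductivity.HubbardSuperconductivity.Theorems.KLProgrammeKLRegimeVolumeLimitExDefs
import Summits.HubbardSuperconductivity.HubbardSuperconductivity.Theorems.KLProgrammeKLRegimeSplitSlotsV17F2

/-!
# Route `KLProgramme` — crux K3 `KLRegimeTwoPointLimit` (stmt-HubbardSuperconductivity-19937): THE K3-NAMED GLUE WITH THE RE-KEYED VOLUME-LIMIT CHILD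
# `VolumeLimitP3` (binder `R.WF2`, located «VL-R-WF2»; twin of `…ChildrenV17F2.KLRegimeTwoPointLimit_of_V17F2` over `…SplitGenericV5`; seat hubbard-kl-k3c4-p1 g18,
# «GO VL» motion of plan g23/g24)

The VL child is re-keyed to `KLRegimeVolumeLimitV17F3 := VolumeLimitP3 klPredsV17F2 FinalTwoLegVolLimitEx klWindowC` (`…SplitGenericV5`, p662771); the other four
gen-8 children are unchanged.  This file is the glue the re-keyed route decl needs, BY NAME:
* `KLRegimeInductionP5` — `KLRegimeInductionP4` with `VolumeLimitP2 ↦ VolumeLimitP3` (`k3_twoPointLimit_of_childrenP5` + S0 `MuOfDopingWindow_holds`), any bundle;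
* **`KLRegimeTwoPointLimit_of_V17F3`** — `EngineP4 klPredsV17F2 klWindowC → BetaSplitP … → CountertermP2 … → VolumeLimitP3 klPredsV17F2 FinalTwoLegVolLimitEx klWindowC →
  TwoPointAssemblyP3 … → …Theses.KLProgramme.KLRegimeTwoPointLimit`.
Proofs only (compositions); nothing asserts any child, K3 or superconductivity.
-/

noncomputable section

namespace Summit.HubbardSuperconductivity.HubbardSuperconductivity.Theorems.KLRegimeSplit

set_option linter.dupNamespace false -- summit = problem name (single-conjunct summit), D-0017

/-- **The K3-named glue, v5** (`VolumeLimitP3` in place of `VolumeLimitP2`; `KLRegimeInductionP4` verbatim otherwise). [folklore: composition] -/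
theorem KLRegimeInductionP5 (Pr : Preds) (VL : VolLimitSlot) (h₃ : EngineP4 Pr klWindowC) (h₁ : BetaSplitP Pr klWindowC)
    (h₂ : CountertermP2 Pr klWindowC) (h₅ : VolumeLimitP3 Pr VL klWindowC) (h₄ : TwoPointAssemblyP3 Pr VL klWindowC) :
    Summit.HubbardSuperconductivity.HubbardSuperconductivity.Theses.KLProgramme.KLRegimeTwoPointLimit :=
  k3_twoPointLimit_of_childrenP5 h₃ h₁ h₂ h₅ h₄
    Summit.HubbardSuperconductivity.HubbardSuperconductivity.Theses.KLProgramme.MuOfDopingWindow_holds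

/-- **THE K3-NAMED GLUE AT `klPredsV17F2` WITH THE RE-KEYED VOLUME-LIMIT CHILD**: the gen-8 children with child 5 := `VolumeLimitP3 klPredsV17F2
FinalTwoLegVolLimitEx klWindowC` (binder `R.WF2`) imply crux K3 `KLRegimeTwoPointLimit` BY NAME. [folklore: composition] -/
theorem KLRegimeTwoPointLimit_of_V17F3 :
    EngineP4 klPredsV17F2 klWindowC → BetaSplitP klPredsV17F2 klWindowC → CountertermP2 klPredsV17F2 klWindowC →
      VolumeLimitP3 klPredsV17F2 FinalTwoLegVolLimitEx klWindowC → TwoPointAssemblyP3 klPredsV17F2 FinalTwoLegVolLimitEx klWindowC →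
        Summit.HubbardSuperconductivity.HubbardSuperconductivity.Theses.KLProgramme.KLRegimeTwoPointLimit :=
  KLRegimeInductionP5 klPredsV17F2 FinalTwoLegVolLimitEx

end Summit.HubbardSuperconductivity.HubbardSuperconductivity.Theorems.KLRegimeSplit

end
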